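import Literature.AlgebraicGeometry.Hironaka2017.Proofs.S09LLUED.Lem95CoupledCountermodel
import HarnessLib

/-!
# Kill test K2.5 (register #44; slot W2.5 = L-47B-s3) on the carrier SW — companion: the SIDE REMARK of
# PREREG-K25.md §B9 (NOT scored, OUTSIDE the MODEL; unit res-L1-k25 = res-D-pv-021)

[OURS · L W2.5 · K2.5] The SW obstruction to the coupled depth choice of Lemma 9.5 (GAP row R47 (B); carrier
`Lem95CoupledCountermodel` p489606: `g = y² + εW`, `εW = Σ_k ω₁^{2k} ω₂³ ∈ 𝔽₂⟦y, ω₁, ω₂⟧`) is PRESENTATION-BOUND: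
`(1 + ω₁²)·εW = ω₂³` (`one_add_sq_mul_εW`) and, in characteristic 2, `(1 + ω₁)²·(y² + εW) = (y(1 + ω₁))² + ω₂³`
(`presentation_identity`); so in the regular parameters `(y′ = y(1 + ω₁), ω₁, ω₂)` the ideal `(g)` is `(y′² + ω₂³)`,
whose `ε″ = ω₂³` has a ONE-monomial AB-ray (`γ₀ = e₂` at every depth, `|α + qγ₀| = 3`). The unit `(1 + ω₁)² = 1 + ω₁²`
lies in `ρ¹(O)` but is not a `ρ^ℓ`-unit for `ℓ ≥ 2`, and re-choosing the distinguished parameter `y` is NOT a move the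
pre-registered condition (iii) allows — recorded for the adjudicator res-adj-2 and the s3 typer res-type-054 only; it
does not enter T1–T3 (main file `MarkedTransferCampaignW25FiniteRaySW.lean`). Nothing here is a statement of the
manuscript [Hironaka2017] (lit key `paper:url-3343fd9e678b`), which stays «under review» (D-0012/D-0089).
AI-written; weaker than expert review.

## References
* H. Hironaka, ms. 2017-03-23, §7.5 p.40 l.37–44 (the form `g = y^q + ε`), §9.3 Eq. (76) p.49 (UNDER ADJUDICATION,
  not cited as fact). [Hironaka2017]
-/

-- `Summit.<Summit>.<Sub>.Theorems` with `Sub = Summit` (single-conjunct summit, D-0017)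
set_option linter.dupNamespace false

noncomputable section

namespace Summit.ResolutionOfSingularities.ResolutionOfSingularities.Theorems.CampaignW25.SW

open MvPowerSeries
open Literature.AlgebraicGeometry.Hironaka2017.S09LLUED.Lem95CoupledCountermodel
open Literature.AlgebraicGeometry.Hironaka2017.S07Permissible (yVar)
open Literature.AlgebraicGeometry.Hironaka2017.S07Permissible.Cor720Countermodel (𝔽)

/-! ## The two identities -/

/-- The coefficients of `εW` (definition, p489606). [folklore] -/
private theorem coeff_εW (d : Option (Fin 2) →₀ ℕ) :
    coeff d εW = if d none = 0 ∧ 2 ∣ d (some 0) ∧ d (some 1) = 3 then 1 else 0 := rfl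

/-- **`(1 + ω₁²) · εW = ω₂³`** in `𝔽₂⟦y, ω₁, ω₂⟧`: the infinite AB-ray of SW is `ω₂³` times the inverse of the
`ρ`-unit `1 + ω₁² = (1 + ω₁)²`. [folklore] -/
theorem one_add_sq_mul_εW :
    (1 + X (some 0 : Option (Fin 2)) ^ 2) * εW = X (some 1 : Option (Fin 2)) ^ 3 := by
  have hs0 : (some 0 : Option (Fin 2)) ≠ none := by decide
  have hs1 : (some 1 : Option (Fin 2)) ≠ none := by decide
  have h01 : (some 0 : Option (Fin 2)) ≠ some 1 := by decide
  ext d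
  rw [add_mul, one_mul, map_add, X_pow_eq, coeff_monomial_mul, coeff_X_pow, coeff_εW]
  by_cases hle : Finsupp.single (some 0 : Option (Fin 2)) 2 ≤ d
  · -- `ω₁`-exponent ≥ 2: the two copies of the ray cancel in characteristic 2; the right side is 0
    rw [if_pos hle, coeff_εW]
    have hd0 : 2 ≤ d (some 0) := by simpa using hle (some 0)
    set s2 : Option (Fin 2) →₀ ℕ := Finsupp.single (some 0 : Option (Fin 2)) 2 with hs2
    have e0 : (d - s2) none = d none := by
      simp [s2, Finsupp.single_eq_of_ne hs0.symm]
    have e1 : (d - s2) (some 0) = d (some 0) - 2 := by simp [s2]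
    have e2 : (d - s2) (some 1) = d (some 1) := by
      simp [s2, Finsupp.single_eq_of_ne (Ne.symm h01)]
    rw [e0, e1, e2]
    have hiff : (2 ∣ d (some 0) - 2) ↔ 2 ∣ d (some 0) := by
      constructor
      · rintro ⟨k, hk⟩; exact ⟨k + 1, by omega⟩
      · rintro ⟨k, hk⟩; exact ⟨k - 1, by omega⟩
    have hne : d ≠ Finsupp.single (some 1) 3 := by
      intro h
      rw [h, Finsupp.single_eq_of_ne h01] at hd0
      omega
    rw [if_neg hne]
    by_cases hP : d none = 0 ∧ 2 ∣ d (some 0) ∧ d (some 1) = 3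
    · rw [if_pos hP, if_pos ⟨hP.1, hiff.2 hP.2.1, hP.2.2⟩]
      decide
    · rw [if_neg hP, if_neg (fun h => hP ⟨h.1, hiff.1 h.2.1, h.2.2⟩)]
      simp
  · -- `ω₁`-exponent ≤ 1: only `εW` contributes; its monomials here are exactly `ω₂³`
    rw [if_neg hle, add_zero]
    have hd0 : d (some 0) < 2 := by
      by_contra h
      apply hle
      intro i
      by_cases hi : i = some 0
      · subst hi; simp; omega
      · simp [Finsupp.single_eq_of_ne hi]
    by_cases hP : d none = 0 ∧ 2 ∣ d (some 0) ∧ d (some 1) = 3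
    · have hd : d = Finsupp.single (some 1) 3 := by
        obtain ⟨h0, ⟨k, hk⟩, h2⟩ := hP
        ext i
        rcases i with _ | i
        · simp [h0]
        · fin_cases i
          · simp; omega
          · simpa using h2
      rw [if_pos hP, if_pos hd]
    · rw [if_neg hP, if_neg]
      intro hd
      apply hP
      rw [hd]
      simp [Finsupp.single_eq_of_ne hs1.symm, Finsupp.single_eq_of_ne h01]

/-- **The presentation identity** (characteristic 2): `(1 + ω₁)² · (y² + εW) = (y · (1 + ω₁))² + ω₂³` — in the
regular parameters `(y′ = y(1 + ω₁), ω₁, ω₂)` the SW ideal `(g)` is `(y′² + ω₂³)` with a ONE-monomial AB-ray.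
NOT a move allowed by (iii); recorded for the adjudicator only. [folklore] -/
theorem presentation_identity :
    (1 + X (some 0 : Option (Fin 2))) ^ 2 * (yVar 𝔽 2 ^ 2 + εW) =
      (yVar 𝔽 2 * (1 + X (some 0 : Option (Fin 2)))) ^ 2 + X (some 1 : Option (Fin 2)) ^ 3 := by
  have h2 : (2 : O₂) = 0 := by
    have h : (2 : 𝔽) = 0 := by decide
    calc (2 : O₂) = algebraMap 𝔽 O₂ 2 := (map_ofNat (algebraMap 𝔽 O₂) 2).symm
      _ = 0 := by rw [h, map_zero]
  have hε := one_add_sq_mul_εW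
  linear_combination hε + (X (some 0 : Option (Fin 2)) * εW) * h2

end Summit.ResolutionOfSingularities.ResolutionOfSingularities.Theorems.CampaignW25.SW

end
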